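import Literature.MathematicalPhysics.QuantumFieldTheory.Balaban1983to89.Beta.TransverseStructure
import Literature.MathematicalPhysics.QuantumFieldTheory.Balaban1983to89.Beta.LeadingCoefficient

/-!
# `Balaban1983to89.Beta.TransverseLink` — the kernel LINK between the transverse-tensor calculus (`Beta/TransverseStructure`,
row lit1) and the (L5) sign row (`Beta/LeadingCoefficient`, row an3): «covariant + transverse leading kernel ⇒ the sign question
of the β sub-cell is the sign of ONE scalar», composed end to end

HONEST FRAMING (cell `pub-balaban`, verbatim rule): discharging `BetaPertH` makes Bałaban's UV stability UNCONDITIONAL — a real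
constructive-QFT result («UNCONDITIONAL» in B16 p.355's interval-hypothesis sense only, BETA-SPEC §8.6(o)); it is NOT the
continuum limit and NOT the Clay problem.  THIS MODULE DISCHARGES NOTHING of the series and asserts NOTHING about Bałaban's
papers: it composes two landed folklore modules.  Value = kernel bookkeeping for item (L5) of the β sub-cell's one open
statement (M2⁺) (BETA-SPEC v1.8e §8.6(m)/(p), §7.7), NOT summit progress.

WHY A SEPARATE FILE.  `Beta/TransverseStructure` (lit1) is Mathlib-only calculus; `Beta/LeadingCoefficient` (an3-g3, p179240
commit ccd6b696c2b0) DEFINES `transverseUnit μ ν x := 24(x_μx_ν)²/normSq x⁴` by closed form and decides everything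
downstream of the sign of `κ` in `leadingIntegrand κ μ ν = κ·transverseUnit μ ν` (`af0L_iff_pos`).  an3-g3's journal NOTE
2026-08-18T20:36:33Z: «if you want a kernel link, a one-line example "x_μ·x_ν·T_{μν}(x) = LeadingCoefficient.transverseUnit μ ν x
(μ ≠ ν, x ≠ 0)" in YOUR module is welcome … No import either way».  Importing `LeadingCoefficient` INTO `TransverseStructure`
would fix the import direction against the natural one (the consumer importing the calculus); this leaf imports both and
nothing imports it.

WHAT IS PROVED (all [folklore]; `x : Fin 4 → ℝ`, `μ ≠ ν`):
* `r2_eq_normSq` — the two modules' squared radii agree definitionally;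
* `offDiag_moment_eq_transverseUnit` — `x_μ·x_ν·T_{μν}(x) = transverseUnit μ ν x` (an3-g3's welcome; `T` =
  `TransverseStructure.transverse` = `(∂_μ∂_ν − δ_{μν}Δ)|x|⁻⁴` with certified partials, `transverseUnit` = an3's closed form) —
  holds at every `x` (both sides are `0` at `x = 0` by Lean's `x/0 = 0`);
* `covFamily_moment_eq_leadingIntegrand` — for the divergence-free member `S^{a,−2a}` of the O(4)-covariant degree-(−6) family
  (`TransverseStructure.divFree_iff`: transversality ⇔ `b = −2a`), `x_μ·x_ν·S^{a,−2a}_{μν}(x) = leadingIntegrand (−a/12) μ ν x`;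
* `af0L_iff_of_covFamily` — COMPOSED SIGN STATEMENT: if Bałaban's `β⁰` admits a `WindowDecomposition` (BETA-SPEC §8.6(m),
  `Beta/LargeLWindow`) whose leading kernel is the (1.22)-moment `w_μw_ν·S^{a,−2a}_{μν}(w)` of a covariant transverse degree-(−6)
  kernel, then `(∃ b > 0, ∃ A, LogGrowthLower β⁰ b A) ↔ a < 0` — (AF-0-L) is EXACTLY the sign of the one scalar
  (`LeadingCoefficient.af0L_iff_pos` with `κ = −a/12`);
* `logGrowthLower_of_covFamily` — the quantitative half: slope `(−a/12)·unitCoeff μ ν/log 2` with the explicit `O(1)`;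
* `af0L_iff_of_field` / `logGrowthLower_of_field` — the GENERAL form via the O(4) classification of `TransverseStructure` v1.1
  §5 (`one_scalar`, p179433 commit 171adb5fca8e): if the leading kernel is the (1.22)-moment `w_μw_ν·S(w)_{μν}` of ANY matrix
  field `S` that is O(4)-covariant, positively homogeneous of degree `−6` and divergence-free off the origin, then
  (AF-0-L) ↔ `S(e₀)₁₁ < 0` — the sign of ONE entry at ONE point (`fieldMomentKernel_eq_leadingIntegrand`: the moment kernel
  equals `leadingIntegrand (−S(e₀)₁₁/12) ∘ toReal` at every lattice point, the origin included).
WHAT IS NOT PROVED / NOT ASSERTED: that Bałaban's reorganised leading window kernel IS of this form (rows (L1)(β)/(L2)/(L3):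
an1/an5/an2; typed hand-over `WindowDecomposition … (leadingIntegrand κ μ ν ∘ toReal)` in `LeadingCoefficient`); any value of `a`/`κ` (context: continuum background-field kernel `κ^{Ω} = −11C_Ag₀²/(48π⁴)`, Dunne–Rius
PLB 293 (1992) (15) = FJL NPB 371 (1992) (II.G.22), CITED-FACTS S-lit1-17 — physics literature, CONTEXT ONLY under the
cell's ABSOLUTE RULE).  Companion prose: HOME/BETA/LIT1.md v1.6 §9.4–9.6; journal CLAIM «BETA-lit1 gen 4» 2026-08-18.
-/

namespace Literature.MathematicalPhysics.QuantumFieldTheory.Balaban1983to89.Beta.TransverseLink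

open Literature.MathematicalPhysics.QuantumFieldTheory.Balaban1983to89.Beta
open Literature.MathematicalPhysics.QuantumFieldTheory.Balaban1983to89.Beta.TransverseStructure
  (r2 transverse covFamily offDiag_moment covFamily_eq_smul_transverse divFree_iff divTerm TensorField IsO4Covariant
    IsHomogNegSix IsDivFree axisPt one_scalar transverse_eq)
open Literature.MathematicalPhysics.QuantumFieldTheory.Balaban1983to89.Beta.LeadingCoefficient
  (normSq transverseUnit leadingIntegrand leadingIntegrand_apply af0L_iff_pos logGrowthLower_of_window unitCoeff)
open Literature.MathematicalPhysics.QuantumFieldTheory.Balaban1983to89.Beta.DyadicShell (Pt toReal)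
open Literature.MathematicalPhysics.QuantumFieldTheory.Balaban1983to89.Beta.LargeLWindow (WindowDecomposition)
open Literature.MathematicalPhysics.QuantumFieldTheory.Balaban1983to89.Beta.LargeL (LogGrowthLower)

noncomputable section

/-! ## 1. The two modules' objects agree -/

/-- The squared Euclidean radius of `TransverseStructure` IS the `normSq` of `LeadingCoefficient` (both `Σ_i x_i²`).
[folklore] -/
theorem r2_eq_normSq (x : Fin 4 → ℝ) : r2 x = normSq x := rfl

/-- **THE LINK** (an3-g3's welcome, journal NOTE 2026-08-18T20:36:33Z): for `μ ≠ ν`,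
`x_μ·x_ν·T_{μν}(x) = transverseUnit μ ν x`, `T = (∂_μ∂_ν − δ_{μν}Δ)|x|⁻⁴` with the certified partials of `TransverseStructure`
§2 and `transverseUnit` an3's closed form `24(x_μx_ν)²/normSq⁴`. [folklore] -/
theorem offDiag_moment_eq_transverseUnit {μ ν : Fin 4} (h : μ ≠ ν) (x : Fin 4 → ℝ) :
    x μ * x ν * transverse μ ν x = transverseUnit μ ν x := by
  rw [offDiag_moment h, transverseUnit, ← r2_eq_normSq]
  ring

/-- Hence the (1.22)-moment of `κ·T` is an3's `leadingIntegrand κ`. [folklore] -/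
theorem smul_moment_eq_leadingIntegrand {μ ν : Fin 4} (h : μ ≠ ν) (κ : ℝ) (x : Fin 4 → ℝ) :
    x μ * x ν * (κ * transverse μ ν x) = leadingIntegrand κ μ ν x := by
  rw [leadingIntegrand_apply, ← offDiag_moment_eq_transverseUnit h]
  ring

/-- For the divergence-free member `S^{a,−2a}` of the covariant family (`divFree_iff`): its (1.22)-moment is
`leadingIntegrand (−a/12)`. [folklore] -/
theorem covFamily_moment_eq_leadingIntegrand {μ ν : Fin 4} (h : μ ≠ ν) (a : ℝ) (x : Fin 4 → ℝ) :
    x μ * x ν * covFamily a (-2 * a) μ ν x = leadingIntegrand (-a / 12) μ ν x := by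
  rw [covFamily_eq_smul_transverse, smul_moment_eq_leadingIntegrand h]

/-! ## 2. The composed sign statement -/

section Composed

variable {β0 : ℕ → ℕ → ℝ} {Ch Cg A₁ c : ℝ} {M : ℕ → ℕ} {μ ν : Fin 4} {a b : ℝ}

/-- The leading-kernel hypothesis in lit1's vocabulary: the window kernel is the (1.22)-moment `w_μw_ν·S^{a,b}_{μν}(w)` of a
member of the covariant degree-(−6) family. [folklore] -/
def momentKernel (a b : ℝ) (μ ν : Fin 4) : Pt → ℝ :=
  fun w => toReal w μ * toReal w ν * covFamily a b μ ν (toReal w)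

/-- With `b = −2a` (transversality) the moment kernel IS an3's `leadingIntegrand (−a/12) ∘ toReal`. [folklore] -/
theorem momentKernel_eq_leadingIntegrand (h : μ ≠ ν) (a : ℝ) :
    momentKernel a (-2 * a) μ ν = fun w => leadingIntegrand (-a / 12) μ ν (toReal w) :=
  funext fun w => covFamily_moment_eq_leadingIntegrand h a (toReal w)

/-- **COMPOSED SIGN STATEMENT.**  If `β⁰` admits a `WindowDecomposition` whose leading kernel is the (1.22)-moment of the
transverse member `S^{a,−2a}` of the O(4)-covariant degree-(−6) family, then (AF-0-L) — `∃ b > 0, ∃ A, β⁰_{k+1}(L) ≥ b·log L − A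
for all L ≥ 2, all k` — holds IF AND ONLY IF `a < 0` (equivalently `κ = −a/12 > 0`): `LeadingCoefficient.af0L_iff_pos`
composed with `covFamily_moment_eq_leadingIntegrand`.  Which sign Bałaban's kernel has, and whether it is of this form at
all, is rows (L1)(β)/(L2)/(L3) — nothing of it is asserted. [folklore] -/
theorem af0L_iff_of_covFamily (h : μ ≠ ν) (W : WindowDecomposition β0 (momentKernel a (-2 * a) μ ν) Ch Cg A₁ c M) :
    (∃ b A : ℝ, 0 < b ∧ LogGrowthLower β0 b A) ↔ a < 0 := by
  rw [momentKernel_eq_leadingIntegrand h a] at W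
  rw [af0L_iff_pos W]
  constructor
  · intro hk; linarith
  · intro ha; linarith

/-- The same, entered through the transversality CONDITION of `TransverseStructure.divFree_iff` rather than through the
substitution `b = −2a`: if the covariant family member `S^{a,b}` in the window kernel is divergence-free on `ℝ⁴ ∖ 0`
(certified coordinate divergence `Σ_μ divTerm a b μ ν = 0`), then (AF-0-L) ↔ `a < 0`. [folklore] -/
theorem af0L_iff_of_divFree (h : μ ≠ ν)
    (hdiv : ∀ x : Fin 4 → ℝ, x ≠ 0 → ∀ ν' : Fin 4, ∑ μ', divTerm a b μ' ν' x = 0)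
    (W : WindowDecomposition β0 (momentKernel a b μ ν) Ch Cg A₁ c M) :
    (∃ b' A : ℝ, 0 < b' ∧ LogGrowthLower β0 b' A) ↔ a < 0 := by
  have hb : b = -2 * a := (divFree_iff a b).mp hdiv
  subst hb
  exact af0L_iff_of_covFamily h W

/-- The quantitative half for the record: under the same hypothesis and `a ≤ 0`, (AF-0-L) with slope
`(−a/12)·unitCoeff μ ν / log 2` and the explicit `O(1)` of `WindowDecomposition.constA`. [folklore] -/
theorem logGrowthLower_of_covFamily (h : μ ≠ ν) (W : WindowDecomposition β0 (momentKernel a (-2 * a) μ ν) Ch Cg A₁ c M)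
    (ha : a ≤ 0) :
    LogGrowthLower β0 (-a / 12 * unitCoeff μ ν / Real.log 2)
      (WindowDecomposition.constA Ch Cg A₁ c (-a / 12 * unitCoeff μ ν)) := by
  rw [momentKernel_eq_leadingIntegrand h a] at W
  exact logGrowthLower_of_window W (by linarith)

/-! ## 3. The composed statement for a GENERAL matrix field, via the O(4) classification (`TransverseStructure` v1.1 §5) -/

/-- The window kernel built from a general matrix field `S` on `ℝ⁴`: the (1.22)-moment `w_μw_ν·S(w)_{μν}`. [folklore] -/
def fieldMomentKernel (S : TensorField) (μ ν : Fin 4) : Pt → ℝ :=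
  fun w => toReal w μ * toReal w ν * S (toReal w) μ ν

/-- If `S` is O(4)-covariant, positively homogeneous of degree `−6` and divergence-free off the origin, its moment kernel IS
`leadingIntegrand (−S(e₀)₁₁/12) ∘ toReal` — at EVERY lattice point, the origin included (there both sides vanish because of
the prefactor `w_μw_ν`, whatever `S 0` is).  (`TransverseStructure.one_scalar`.) [folklore] -/
theorem fieldMomentKernel_eq_leadingIntegrand {S : TensorField} (hS : IsO4Covariant S) (hH : IsHomogNegSix S)
    (hD : IsDivFree S) (h : μ ≠ ν) :
    fieldMomentKernel S μ ν = fun w => leadingIntegrand (-(S (axisPt 1) 1 1) / 12) μ ν (toReal w) := by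
  funext w
  unfold fieldMomentKernel
  by_cases hw : toReal w = 0
  · rw [hw, leadingIntegrand_apply, transverseUnit]
    simp
  · rw [one_scalar hS hH hD hw μ ν, smul_moment_eq_leadingIntegrand h]

/-- **COMPOSED SIGN STATEMENT, GENERAL FORM.**  If `β⁰` admits a `WindowDecomposition` whose leading kernel is the (1.22)-moment
of a matrix field `S` that is O(4)-covariant, positively homogeneous of degree `−6` and divergence-free off the origin
(background-gauge transversality at separated points), then (AF-0-L) holds IF AND ONLY IF `S(e₀)₁₁ < 0` — the sign question
is the sign of ONE entry of `S` at ONE point.  (For the continuum one-loop kernel in the Ω-orientation this entry is the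
`δ_{μν}`-coefficient `−12κ` at `e₀`, so the condition reads `κ > 0` in Bałaban's orientation — CONTEXT, AN3.md v3 §6.5 (D3);
nothing about Bałaban's kernel is asserted here.) [folklore] -/
theorem af0L_iff_of_field {S : TensorField} (hS : IsO4Covariant S) (hH : IsHomogNegSix S) (hD : IsDivFree S) (h : μ ≠ ν)
    (W : WindowDecomposition β0 (fieldMomentKernel S μ ν) Ch Cg A₁ c M) :
    (∃ b A : ℝ, 0 < b ∧ LogGrowthLower β0 b A) ↔ S (axisPt 1) 1 1 < 0 := by
  rw [fieldMomentKernel_eq_leadingIntegrand hS hH hD h] at W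
  rw [af0L_iff_pos W]
  constructor
  · intro hk; linarith
  · intro ha; linarith

/-- … and the quantitative half: slope `(−S(e₀)₁₁/12)·unitCoeff μ ν/log 2` with the explicit `O(1)`, when `S(e₀)₁₁ ≤ 0`.
[folklore] -/
theorem logGrowthLower_of_field {S : TensorField} (hS : IsO4Covariant S) (hH : IsHomogNegSix S) (hD : IsDivFree S)
    (h : μ ≠ ν) (W : WindowDecomposition β0 (fieldMomentKernel S μ ν) Ch Cg A₁ c M) (hle : S (axisPt 1) 1 1 ≤ 0) :
    LogGrowthLower β0 (-(S (axisPt 1) 1 1) / 12 * unitCoeff μ ν / Real.log 2)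
      (WindowDecomposition.constA Ch Cg A₁ c (-(S (axisPt 1) 1 1) / 12 * unitCoeff μ ν)) := by
  rw [fieldMomentKernel_eq_leadingIntegrand hS hH hD h] at W
  exact logGrowthLower_of_window W (by linarith)

end Composed

/-- Non-vacuity / sanity of the link at `x = (1,1,0,0)`: `r2 = 2`, `x₀x₁T₀₁ = 3/2 = transverseUnit 0 1 x`. -/
example : transverseUnit 0 1 (fun i : Fin 4 => if i = 0 ∨ i = 1 then (1 : ℝ) else 0) = 3 / 2 := by
  set x : Fin 4 → ℝ := fun i => if i = 0 ∨ i = 1 then (1 : ℝ) else 0 with hxdef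
  rw [← offDiag_moment_eq_transverseUnit (show (0 : Fin 4) ≠ 1 by decide), offDiag_moment (show (0 : Fin 4) ≠ 1 by decide)]
  have hr : r2 x = 2 := by
    rw [hxdef, r2, Fin.sum_univ_four]
    norm_num [Fin.ext_iff]
  rw [hr, hxdef]
  norm_num

end

end Literature.MathematicalPhysics.QuantumFieldTheory.Balaban1983to89.Beta.TransverseLink
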